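import Literature.MathematicalPhysics.QuantumFieldTheory.GaussianDoubleCommutatorKernel
import HarnessLib

/-!
# Exponential domination of the double-commutator feature; two unitary-matrix trace identities

Theorem-only complements to `GaussianDoubleCommutatorKernel.lean`, used by the proof of
Borgs–Seiler's infrared bound (`Literature.Barriers.QuantumFields.FiniteTemperatureInfraredExplicitProofs`)
to exchange the `η`-integral defining the Gram kernel `𝒦 = dcKernel J F` with an integral over a
compact configuration space (Fubini):

* `continuous_gaussFeature`, `continuous_dcFeature` — joint continuity of `φ_η(v)`, `Ψ_η(v)` in `(η, v)`;
* `norm_le_sum_abs`, `gaussFeature_le`, **`norm_dcFeature_le`** — on the unit cube `‖v‖ ≤ 1`, for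
  `‖F v‖ ≤ C (1 + ‖v‖)^p`: `‖Ψ_η(v)‖ ≤ 2C (2 + J⁻¹)^p exp((p + 1) Σᵢ |ηᵢ|)`;
* **`integrable_exp_mul_sum_abs`** — `η ↦ exp(κ Σᵢ |ηᵢ|)` is integrable for the product Gaussian
  `γ = ⨂ N(0, J)` (Mathlib's `integrable_exp_mul_gaussianReal` coordinatewise,
  `Integrable.fintype_prod`);
* `trace_re_mul_conjTranspose_comm` (`Re tr(A Bᴴ) = Re tr(B Aᴴ)`) and
  `sum_normSq_sub_of_unitary` (`Σ_{ab} |A_{ab} − B_{ab}|² = 2N − 2 Re tr(B Aᴴ)` for unitary `A, B`: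
  the electric crossing energy of a lattice gauge theory is a Gaussian kernel in the real
  coordinates of the link matrices, Borgs–Seiler (III.34)–(III.35)).

Everything here is proved; no named fact. [folklore]

## References

* C. Borgs, E. Seiler, Comm. Math. Phys. 91 (1983) 329–380, §III.2 (III.34)–(III.41) (pp. 349–350).
  [BorgsSeiler1983]
-/

noncomputable section

namespace Literature.MathematicalPhysics.QuantumFieldTheory

open MeasureTheory ProbabilityTheory
open scoped NNReal ComplexConjugate Matrix

section DCBounds

variable {ι : Type*} [Fintype ι] (J : ℝ≥0) {F : (ι → ℝ) → ℂ}

/-- The Gaussian feature is continuous in `(η, v)`. [folklore] -/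
theorem continuous_gaussFeature : Continuous fun p : (ι → ℝ) × (ι → ℝ) => gaussFeature J p.1 p.2 := by
  unfold gaussFeature
  fun_prop

/-- The double-commutator feature is continuous in `(η, v)` for continuous `F`. [folklore] -/
theorem continuous_dcFeature (hF : Continuous F) : Continuous fun p : (ι → ℝ) × (ι → ℝ) => dcFeature J F p.1 p.2 := by
  unfold dcFeature
  refine Continuous.mul ((hF.comp continuous_snd).sub (hF.comp ?_))
    (Complex.continuous_ofReal.comp (continuous_gaussFeature J))
  fun_prop

/-- `‖η‖ ≤ Σᵢ |ηᵢ|` for the sup norm. [folklore] -/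
theorem norm_le_sum_abs (η : ι → ℝ) : ‖η‖ ≤ ∑ i, |η i| := by
  refine (pi_norm_le_iff_of_nonneg (Finset.sum_nonneg fun i _ => abs_nonneg (η i))).2 fun i => ?_
  rw [Real.norm_eq_abs]
  exact Finset.single_le_sum (f := fun j => |η j|) (fun j _ => abs_nonneg _) (Finset.mem_univ i)

/-- The Gaussian feature on the unit cube: `φ_η(v) ≤ exp(Σᵢ |ηᵢ|)` for `‖v‖ ≤ 1`. [folklore] -/
theorem gaussFeature_le (η v : ι → ℝ) (hv : ‖v‖ ≤ 1) : gaussFeature J η v ≤ Real.exp (∑ i, |η i|) := by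
  unfold gaussFeature
  refine Real.exp_le_exp.2 ?_
  have h1 : ∑ i, η i * v i ≤ ∑ i, |η i| := Finset.sum_le_sum fun i _ => by
    have hvi : |v i| ≤ 1 := by
      have := norm_le_pi_norm v i
      rw [Real.norm_eq_abs] at this
      exact this.trans hv
    calc η i * v i ≤ |η i * v i| := le_abs_self _
      _ = |η i| * |v i| := abs_mul _ _
      _ ≤ |η i| * 1 := mul_le_mul_of_nonneg_left hvi (abs_nonneg _)
      _ = |η i| := mul_one _
  have h2 : 0 ≤ (J : ℝ) * ∑ i, v i ^ 2 := mul_nonneg J.coe_nonneg (Finset.sum_nonneg fun i _ => sq_nonneg _)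
  linarith

/-- **Exponential domination of the double-commutator feature on the unit cube**: if
`‖F v‖ ≤ C (1 + ‖v‖)^p` then for `‖v‖ ≤ 1`,
`‖Ψ_η(v)‖ ≤ 2C (2 + J⁻¹)^p exp((p + 1) Σᵢ |ηᵢ|)`. [folklore] -/
theorem norm_dcFeature_le {C : ℝ} {p : ℕ} (hC : 0 ≤ C) (hFb : ∀ v, ‖F v‖ ≤ C * (1 + ‖v‖) ^ p)
    (η v : ι → ℝ) (hv : ‖v‖ ≤ 1) :
    ‖dcFeature J F η v‖ ≤ 2 * C * (2 + (J : ℝ)⁻¹) ^ p * Real.exp ((p + 1) * ∑ i, |η i|) := by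
  have hJ0 : 0 ≤ (J : ℝ)⁻¹ := inv_nonneg.2 J.coe_nonneg
  set S : ℝ := ∑ i, |η i| with hS
  have hS0 : 0 ≤ S := Finset.sum_nonneg fun i _ => abs_nonneg _
  have hηS : ‖η‖ ≤ S := norm_le_sum_abs η
  -- `(1 + ‖u‖) ≤ (2 + J⁻¹) exp S` for `u = v` and `u = η/J − v`
  have hexp1 : 1 + S ≤ Real.exp S := by linarith [Real.add_one_le_exp S]
  have hbase : ∀ u : ι → ℝ, ‖u‖ ≤ 1 + (J : ℝ)⁻¹ * ‖η‖ → 1 + ‖u‖ ≤ (2 + (J : ℝ)⁻¹) * Real.exp S := by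
    intro u hu
    have h1 : 1 + ‖u‖ ≤ (2 + (J : ℝ)⁻¹) * (1 + S) := by
      have := mul_le_mul_of_nonneg_left hηS hJ0
      nlinarith
    exact h1.trans (mul_le_mul_of_nonneg_left hexp1 (by positivity))
  have hu1 : ‖v‖ ≤ 1 + (J : ℝ)⁻¹ * ‖η‖ := hv.trans (le_add_of_nonneg_right (mul_nonneg hJ0 (norm_nonneg _)))
  have hu2 : ‖(J : ℝ)⁻¹ • η - v‖ ≤ 1 + (J : ℝ)⁻¹ * ‖η‖ := by
    calc ‖(J : ℝ)⁻¹ • η - v‖ ≤ ‖(J : ℝ)⁻¹ • η‖ + ‖v‖ := norm_sub_le _ _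
      _ = (J : ℝ)⁻¹ * ‖η‖ + ‖v‖ := by rw [norm_smul, Real.norm_eq_abs, abs_of_nonneg hJ0]
      _ ≤ 1 + (J : ℝ)⁻¹ * ‖η‖ := by linarith
  have hpow : ∀ u : ι → ℝ, ‖u‖ ≤ 1 + (J : ℝ)⁻¹ * ‖η‖ →
      C * (1 + ‖u‖) ^ p ≤ C * (2 + (J : ℝ)⁻¹) ^ p * Real.exp (p * S) := by
    intro u hu
    calc C * (1 + ‖u‖) ^ p ≤ C * ((2 + (J : ℝ)⁻¹) * Real.exp S) ^ p := by
          gcongr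
          exact hbase u hu
      _ = C * (2 + (J : ℝ)⁻¹) ^ p * Real.exp (p * S) := by
          rw [mul_pow, ← Real.exp_nat_mul]; ring
  have hgf := gaussFeature_le J η v hv
  have hgf0 : 0 ≤ gaussFeature J η v := (Real.exp_pos _).le
  unfold dcFeature
  rw [norm_mul, Complex.norm_real, Real.norm_of_nonneg hgf0]
  calc ‖F v - F ((J : ℝ)⁻¹ • η - v)‖ * gaussFeature J η v
      ≤ (C * (2 + (J : ℝ)⁻¹) ^ p * Real.exp (p * S) + C * (2 + (J : ℝ)⁻¹) ^ p * Real.exp (p * S)) * Real.exp S := by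
        refine mul_le_mul ((norm_sub_le _ _).trans (add_le_add ((hFb v).trans (hpow v hu1))
          ((hFb _).trans (hpow _ hu2)))) hgf hgf0 (by positivity)
    _ = 2 * C * (2 + (J : ℝ)⁻¹) ^ p * Real.exp ((p + 1) * S) := by
        rw [add_mul (p : ℝ) 1 S, one_mul, Real.exp_add]; ring

/-- **Gaussian exponential moments**: `η ↦ exp(κ Σᵢ |ηᵢ|)` is `γ`-integrable. [folklore] -/
theorem integrable_exp_mul_sum_abs (κ : ℝ) :
    Integrable (fun η : ι → ℝ => Real.exp (κ * ∑ i, |η i|)) (gaussianPi ι J) := by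
  have h : ∀ η : ι → ℝ, Real.exp (κ * ∑ i, |η i|) = ∏ i, Real.exp (κ * |η i|) := fun η => by
    rw [Finset.mul_sum, Real.exp_sum]
  simp_rw [h]
  unfold gaussianPi
  exact Integrable.fintype_prod (f := fun (_ : ι) (x : ℝ) => Real.exp (κ * |x|)) fun _ =>
    integrable_exp_mul_abs (X := fun x : ℝ => x) (integrable_exp_mul_gaussianReal κ)
      (by simpa using integrable_exp_mul_gaussianReal (μ := 0) (v := J) (-κ))

end DCBounds

section UnitaryTrace

variable {N : ℕ}

/-- `Re tr(A Bᴴ) = Re tr(B Aᴴ)`. [folklore] -/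
theorem trace_re_mul_conjTranspose_comm (A B : Matrix (Fin N) (Fin N) ℂ) :
    (A * Bᴴ).trace.re = (B * Aᴴ).trace.re := by
  have h : (B * Aᴴ) = (A * Bᴴ)ᴴ := by rw [Matrix.conjTranspose_mul, Matrix.conjTranspose_conjTranspose]
  rw [h, Matrix.trace_conjTranspose, Complex.star_def, Complex.conj_re]

/-- For unitary `A, B`: `Σ_{ab} |A_{ab} − B_{ab}|² = 2N − 2 Re tr(B Aᴴ)`. [folklore] -/
theorem sum_normSq_sub_of_unitary {A B : Matrix (Fin N) (Fin N) ℂ} (hA : A ∈ Matrix.unitaryGroup (Fin N) ℂ)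
    (hB : B ∈ Matrix.unitaryGroup (Fin N) ℂ) :
    ∑ a, ∑ b, Complex.normSq (A a b - B a b) = 2 * N - 2 * (B * Aᴴ).trace.re := by
  have hsq : ∀ M : Matrix (Fin N) (Fin N) ℂ, M ∈ Matrix.unitaryGroup (Fin N) ℂ →
      ∑ a, ∑ b, Complex.normSq (M a b) = N := by
    intro M hM
    have h1 : (M * Mᴴ) = 1 := by
      have := Matrix.mem_unitaryGroup_iff.1 hM
      rwa [Matrix.star_eq_conjTranspose] at this
    have h2 : ((M * Mᴴ).trace).re = N := by
      rw [h1, Matrix.trace_one, Fintype.card_fin]; simp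
    rw [← h2, Matrix.trace]
    simp only [Matrix.diag, Matrix.mul_apply, Matrix.conjTranspose_apply, Complex.star_def, Complex.re_sum,
      Complex.mul_conj, Complex.ofReal_re]
  have htr : (B * Aᴴ).trace.re = ∑ a, ∑ b, (B a b * conj (A a b)).re := by
    simp only [Matrix.trace, Matrix.diag, Matrix.mul_apply, Matrix.conjTranspose_apply, Complex.star_def,
      Complex.re_sum]
  have hexp : ∀ a b, Complex.normSq (A a b - B a b) =
      Complex.normSq (A a b) + Complex.normSq (B a b) - 2 * (B a b * conj (A a b)).re := by
    intro a b
    rw [Complex.normSq_sub]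
    congr 1
    rw [Complex.mul_re, Complex.conj_re, Complex.conj_im, Complex.mul_re, Complex.conj_re, Complex.conj_im]
    ring
  simp_rw [hexp, Finset.sum_sub_distrib, Finset.sum_add_distrib, hsq A hA, hsq B hB, htr, Finset.mul_sum]
  ring

end UnitaryTrace

end Literature.MathematicalPhysics.QuantumFieldTheory

end
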